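import Summits.AtomisticToContinuum.Crystallization.Theorems.HullExactificationCascadeHullBulkOptimalCut
import Literature.MathematicalPhysics.StatisticalMechanics.LocalMatchingCompactness

/-!
# Crux `BarlowLiouville` (stmt-AtomisticToContinuum-15801), line `Sketch` — certificate glue

Sorry-free bookkeeping for the rev-6 skeleton of the line (lead prover-line-stmt-AtomisticToContinuum-15801-c1-0):
summing a SITEWISE CERTIFICATE (calibrated site excess `h y − 2e − flux y ≥ −θ` everywhere and `≥ κ − θ` at the
bad sites) over the points of a `δ`-separated `X ⊆ ℝ³` in a closed ball, given a bound `C (L+1)²` on the total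
flux out of every ball, yields the registered price-with-slack inequality
`κ · #bad − C (L+1)² − θ · n ≤ Σ h − 2e · n` (`priceSlack_of_certificate_flux`). This is how the kernel
`stub_priceSlack` follows from the stubs `stub_siteCertificate` + `stub_fluxBookkeeping`. Pure real/finite
bookkeeping, no definitions. [folklore]
-/

noncomputable section

namespace Summit.AtomisticToContinuum.Crystallization.Theorems.DisclinationRationBarlowLiouville

open Literature.MathematicalPhysics.StatisticalMechanics
open Summit.AtomisticToContinuum.Crystallization.Theorems.HullBulkOptimal (tsum_finite_eq_sum)

/-- **Summing a sitewise certificate over a ball.** In a `δ`-separated `X`, if every site has calibrated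
excess `h y − 2e − flux y ≥ −θ`, the `P`-bad sites have `≥ κ − θ`, and the total flux out of every closed
ball is `≤ C (L+1)²` in absolute value, then
`κ · #{y ∈ X ∩ B̄_L(ctr) : ¬P y} − C (L+1)² − θ · #(X ∩ B̄_L(ctr)) ≤ Σ_{y ∈ X ∩ B̄_L(ctr)} h y − 2e · #(X ∩ B̄_L(ctr))`
(pure bookkeeping: the ball meets `X` in a finite set, the `tsum`s are `Finset` sums). [folklore] -/
theorem priceSlack_of_certificate_flux {δ : ℝ} (hδ : 0 < δ) {X : Set (EuclideanSpace ℝ (Fin 3))}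
    (hsep : ∀ y ∈ X, ∀ z ∈ X, y ≠ z → δ ≤ dist y z)
    (P : (EuclideanSpace ℝ (Fin 3)) → Prop) (hX flux : (EuclideanSpace ℝ (Fin 3)) → ℝ) (e κ θ C : ℝ)
    (hall : ∀ y ∈ X, -θ ≤ hX y - 2 * e - flux y)
    (hbad : ∀ y ∈ X, ¬ P y → κ - θ ≤ hX y - 2 * e - flux y)
    (hC : ∀ (ctr : (EuclideanSpace ℝ (Fin 3))) (L : ℝ),
      |∑' y : ↥{y : (EuclideanSpace ℝ (Fin 3)) | y ∈ X ∧ dist y ctr ≤ L}, flux (y : (EuclideanSpace ℝ (Fin 3)))| ≤ C * (L + 1) ^ 2)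
    (ctr : (EuclideanSpace ℝ (Fin 3))) (L : ℝ) :
    κ * (({y : (EuclideanSpace ℝ (Fin 3)) | y ∈ X ∧ dist y ctr ≤ L ∧ ¬ P y} : Set (EuclideanSpace ℝ (Fin 3))).ncard : ℝ) - C * (L + 1) ^ 2
        - θ * (({y : (EuclideanSpace ℝ (Fin 3)) | y ∈ X ∧ dist y ctr ≤ L} : Set (EuclideanSpace ℝ (Fin 3))).ncard : ℝ) ≤
      (∑' y : ↥{y : (EuclideanSpace ℝ (Fin 3)) | y ∈ X ∧ dist y ctr ≤ L}, hX (y : (EuclideanSpace ℝ (Fin 3))))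
        - 2 * e * (({y : (EuclideanSpace ℝ (Fin 3)) | y ∈ X ∧ dist y ctr ≤ L} : Set (EuclideanSpace ℝ (Fin 3))).ncard : ℝ) := by
  classical
  set W : Set (EuclideanSpace ℝ (Fin 3)) := {y : (EuclideanSpace ℝ (Fin 3)) | y ∈ X ∧ dist y ctr ≤ L} with hW
  have hfin : W.Finite :=
    finite_of_forall_le_dist_of_subset_closedBall hδ
      (fun p hp q hq hpq => hsep p hp.1 q hq.1 hpq) (c := ctr) (R := L)
      (fun p hp => Metric.mem_closedBall.2 hp.2)
  have hWf : ∀ p, p ∈ hfin.toFinset ↔ p ∈ X ∧ dist p ctr ≤ L := fun p => by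
    rw [Set.Finite.mem_toFinset]; rfl
  have htsum_h : (∑' y : ↥W, hX (y : (EuclideanSpace ℝ (Fin 3)))) = ∑ y ∈ hfin.toFinset, hX y := tsum_finite_eq_sum hfin hX
  have htsum_f : (∑' y : ↥W, flux (y : (EuclideanSpace ℝ (Fin 3)))) = ∑ y ∈ hfin.toFinset, flux y := tsum_finite_eq_sum hfin flux
  have hncardW : (W.ncard : ℝ) = hfin.toFinset.card := by
    rw [Set.ncard_eq_toFinset_card W hfin]
  have hbadset : ({y : (EuclideanSpace ℝ (Fin 3)) | y ∈ X ∧ dist y ctr ≤ L ∧ ¬ P y} : Set (EuclideanSpace ℝ (Fin 3))) =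
      ↑(hfin.toFinset.filter fun y => ¬ P y) := by
    ext y
    simp only [Finset.coe_filter, Set.mem_setOf_eq, hWf, and_assoc]
  have hncardB : (({y : (EuclideanSpace ℝ (Fin 3)) | y ∈ X ∧ dist y ctr ≤ L ∧ ¬ P y} : Set (EuclideanSpace ℝ (Fin 3))).ncard : ℝ) =
      (hfin.toFinset.filter fun y => ¬ P y).card := by
    rw [hbadset, Set.ncard_coe_finset]
  have hflux := hC ctr L
  rw [htsum_f] at hflux
  have hpt : ∀ y ∈ hfin.toFinset, (if P y then 0 else κ) - θ ≤ hX y - 2 * e - flux y := by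
    intro y hy
    have hyX := ((hWf y).1 hy).1
    by_cases hp : P y
    · rw [if_pos hp]
      linarith [hall y hyX]
    · rw [if_neg hp]
      exact hbad y hyX hp
  have hsum := Finset.sum_le_sum hpt
  rw [Finset.sum_sub_distrib, Finset.sum_ite, Finset.sum_const_zero, zero_add, Finset.sum_const,
    nsmul_eq_mul, Finset.sum_const, nsmul_eq_mul, Finset.sum_sub_distrib, Finset.sum_sub_distrib,
    Finset.sum_const, nsmul_eq_mul] at hsum
  rw [htsum_h, hncardW, hncardB]
  have h1 := (abs_le.1 hflux).1
  linarith

end Summit.AtomisticToContinuum.Crystallization.Theorems.DisclinationRationBarlowLiouville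

end
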